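import Summits.NavierStokesRegularity.NavierStokesRegularity.Theorems.ExtremiserTransienceNearExtremalTransienceExtremiserLiouvilleConstantSpeedTruncationEnvelopes
import Mathlib.Analysis.SpecialFunctions.SmoothTransition
import Mathlib.Analysis.Calculus.ContDiff.Bounds
import HarnessLib

/-!
# Crux `ExtremiserTransience.NearExtremalTransience` (stmt-NavierStokesRegularity-21883), line `extremiser_liouville`,
# stub K1b — the AXIAL WINDOW CUT-OFF `θ_{R,ρ}(x) = g(x₂/R)·χ_ρ(x)` and its derivative weights `‖Dθ‖ ≲ R⁻¹`, `‖D∇θ‖ ≲ R⁻²`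

`--supports stmt-NavierStokesRegularity-21883` (helper).  Author: prover seat `ns-el-k1b` (g7).  The weight fed into
`…ConstantSpeedCrossTermsAssembly.farCaccioppoli_weighted` for the SLAB RATE: with the one-dimensional profile
`g(t) = H(4t − 1)·H(4 − t/2)` (`H = Real.smoothTransition`; `g = 1` on `[1/2, 6]`, `g = 0` off `(1/4, 8)`, `0 ≤ g ≤ 1`) and the
tree's radial cut-off `χ_ρ = cutoff ρ` (`= 1` on `B̄_ρ`, `= 0` off `B_{2ρ}`), the axial window cut-off is
`θ(x) = g(R⁻¹x₂)·χ_ρ(x)` (written out explicitly in every statement; no definitions are introduced):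

* `axialProfile_*` — smoothness, range `[0,1]`, support and plateau of `g`, uniform bounds on `g′, g″`;
* `contDiff_axialCutoff`, `hasCompactSupport_axialCutoff`, `axialCutoff_nonneg_le_one`, `axialCutoff_eq_one`
  (`= 1` on `{R/2 ≤ x₂ ≤ 6R} ∩ B̄_ρ`), `tsupport_axialCutoff_subset` (`⊆ {R/4 ≤ x₂ ≤ 8R}`);
* `exists_axialCutoff_weights` — ONE constant `K` such that for all `1 ≤ R ≤ ρ` and all `x`:
  `‖Dθ(x)‖ ≤ K/R` and `‖D∇θ(x)‖ ≤ K/R²`, both vanishing off `{R/4 ≤ x₂ ≤ 8R}` (Leibniz for `iteratedFDeriv` of a product,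
  the chain rule through the linear map `x ↦ R⁻¹x₂`, the tree's envelopes `‖Dⁱχ_ρ(x)‖ ≤ c(1+‖x‖)⁻ⁱ` and `‖x‖ ≥ x₂ ≥ R/4` on the
  support).

WHAT THIS IS NOT: K1b is NOT proved; nothing here proves NS regularity. [folklore]
-/

noncomputable section

open Set Filter Topology MeasureTheory Metric Function Real
open scoped ENNReal NNReal Topology InnerProductSpace RealInnerProductSpace ContDiff

namespace Summit.NavierStokesRegularity.NavierStokesRegularity.Theorems

-- the problem directory repeats the summit name (`NavierStokesRegularity/NavierStokesRegularity`)
set_option linter.dupNamespace false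

namespace ExtremiserLiouville

open Literature.Analysis.FluidPDE
open DepletionLadder.KStar DepletionLadder.KStar.HalfSpace

/-! ## 1. The one-dimensional profile `g(t) = H(4t − 1)·H(4 − t/2)` -/

/-- `g` is smooth. [folklore] -/
theorem axialProfile_contDiff :
    ContDiff ℝ ∞ (fun t : ℝ => Real.smoothTransition (4 * t - 1) * Real.smoothTransition (4 - t / 2)) := by
  refine ContDiff.mul ?_ ?_
  · exact Real.smoothTransition.contDiff.comp ((contDiff_const.mul contDiff_id).sub contDiff_const)
  · exact Real.smoothTransition.contDiff.comp (contDiff_const.sub (contDiff_id.div_const _))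

/-- `0 ≤ g ≤ 1`. [folklore] -/
theorem axialProfile_nonneg_le_one (t : ℝ) :
    0 ≤ Real.smoothTransition (4 * t - 1) * Real.smoothTransition (4 - t / 2) ∧
      Real.smoothTransition (4 * t - 1) * Real.smoothTransition (4 - t / 2) ≤ 1 :=
  ⟨mul_nonneg (Real.smoothTransition.nonneg _) (Real.smoothTransition.nonneg _),
    mul_le_one₀ (Real.smoothTransition.le_one _) (Real.smoothTransition.nonneg _) (Real.smoothTransition.le_one _)⟩

/-- `g(t) = 0` for `t ≤ 1/4`. [folklore] -/
theorem axialProfile_eq_zero_of_le {t : ℝ} (ht : t ≤ 1 / 4) :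
    Real.smoothTransition (4 * t - 1) * Real.smoothTransition (4 - t / 2) = 0 := by
  rw [Real.smoothTransition.zero_of_nonpos (by linarith), zero_mul]

/-- `g(t) = 0` for `8 ≤ t`. [folklore] -/
theorem axialProfile_eq_zero_of_ge {t : ℝ} (ht : 8 ≤ t) :
    Real.smoothTransition (4 * t - 1) * Real.smoothTransition (4 - t / 2) = 0 := by
  rw [Real.smoothTransition.zero_of_nonpos (x := 4 - t / 2) (by linarith), mul_zero]

/-- `g(t) = 1` for `1/2 ≤ t ≤ 6`. [folklore] -/
theorem axialProfile_eq_one {t : ℝ} (h1 : 1 / 2 ≤ t) (h2 : t ≤ 6) :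
    Real.smoothTransition (4 * t - 1) * Real.smoothTransition (4 - t / 2) = 1 := by
  rw [Real.smoothTransition.one_of_one_le (by linarith), Real.smoothTransition.one_of_one_le (by linarith), mul_one]

/-- `g` has compact support (inside `[1/4, 8]`). [folklore] -/
theorem axialProfile_hasCompactSupport :
    HasCompactSupport (fun t : ℝ => Real.smoothTransition (4 * t - 1) * Real.smoothTransition (4 - t / 2)) := by
  refine HasCompactSupport.of_support_subset_isCompact (isCompact_Icc (a := 1 / 4) (b := 8)) fun t ht => ?_
  rw [mem_support] at ht
  refine ⟨?_, ?_⟩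
  · by_contra h; exact ht (axialProfile_eq_zero_of_le (not_le.1 h).le)
  · by_contra h; exact ht (axialProfile_eq_zero_of_ge (not_le.1 h).le)

/-- Uniform bounds on the first two derivatives of `g`. [folklore] -/
theorem exists_axialProfile_iteratedFDeriv_le :
    ∃ Kg : ℝ, 0 ≤ Kg ∧ ∀ i : ℕ, i ≤ 2 → ∀ t : ℝ,
      ‖iteratedFDeriv ℝ i (fun t : ℝ => Real.smoothTransition (4 * t - 1) * Real.smoothTransition (4 - t / 2)) t‖ ≤ Kg := by
  set g := fun t : ℝ => Real.smoothTransition (4 * t - 1) * Real.smoothTransition (4 - t / 2) with hg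
  have hb : ∀ i : ℕ, ∃ b : ℝ, 0 ≤ b ∧ ∀ t, ‖iteratedFDeriv ℝ i g t‖ ≤ b := fun i => by
    obtain ⟨b, hb⟩ := (axialProfile_contDiff.continuous_iteratedFDeriv (m := i) (by exact_mod_cast le_top)).bounded_above_of_compact_support
      (axialProfile_hasCompactSupport.iteratedFDeriv (𝕜 := ℝ) i)
    exact ⟨max b 0, le_max_right _ _, fun t => (hb t).trans (le_max_left _ _)⟩
  obtain ⟨b0, hb00, hb0⟩ := hb 0
  obtain ⟨b1, hb10, hb1⟩ := hb 1
  obtain ⟨b2, hb20, hb2⟩ := hb 2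
  refine ⟨b0 + b1 + b2, by positivity, fun i hi t => ?_⟩
  interval_cases i
  · exact (hb0 t).trans (by linarith)
  · exact (hb1 t).trans (by linarith)
  · exact (hb2 t).trans (by linarith)

/-! ## 2. The axial window cut-off `θ(x) = g(R⁻¹ x₂) · χ_ρ(x)` -/

/-- The coordinate functional `x ↦ R⁻¹x₂` as a continuous linear map, with norm `≤ R⁻¹` (`R > 0`). [folklore] -/
theorem norm_axialCoordCLM_le {R : ℝ} (hR : 0 < R) :
    ‖(R⁻¹ : ℝ) • (EuclideanSpace.proj (2 : Fin 3) : E3 →L[ℝ] ℝ)‖ ≤ R⁻¹ := by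
  refine ContinuousLinearMap.opNorm_le_bound _ (inv_nonneg.2 hR.le) fun x => ?_
  change ‖R⁻¹ • ((EuclideanSpace.proj (2 : Fin 3) : E3 →L[ℝ] ℝ) x)‖ ≤ R⁻¹ * ‖x‖
  rw [norm_smul, norm_inv, Real.norm_of_nonneg hR.le]
  refine mul_le_mul_of_nonneg_left ?_ (inv_nonneg.2 hR.le)
  change ‖x 2‖ ≤ ‖x‖
  exact PiLp.norm_apply_le (p := 2) x (2 : Fin 3)

/-- `θ` is smooth. [folklore] -/
theorem contDiff_axialCutoff (R ρ : ℝ) :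
    ContDiff ℝ ∞ (fun x : E3 => Real.smoothTransition (4 * (R⁻¹ * x 2) - 1) * Real.smoothTransition (4 - R⁻¹ * x 2 / 2) *
      cutoff ρ x) := by
  have hℓ : ContDiff ℝ ∞ (fun x : E3 => R⁻¹ * x 2) :=
    contDiff_const.mul ((EuclideanSpace.proj (2 : Fin 3) : E3 →L[ℝ] ℝ).contDiff)
  exact (axialProfile_contDiff.comp hℓ).mul (contDiff_cutoff ρ)

/-- `θ` has compact support (`ρ > 0`). [folklore] -/
theorem hasCompactSupport_axialCutoff (R : ℝ) {ρ : ℝ} (hρ : 0 < ρ) :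
    HasCompactSupport (fun x : E3 => Real.smoothTransition (4 * (R⁻¹ * x 2) - 1) * Real.smoothTransition (4 - R⁻¹ * x 2 / 2) *
      cutoff ρ x) :=
  (hasCompactSupport_cutoff hρ).mul_left

/-- `0 ≤ θ ≤ 1`. [folklore] -/
theorem axialCutoff_nonneg_le_one (R ρ : ℝ) (x : E3) :
    0 ≤ Real.smoothTransition (4 * (R⁻¹ * x 2) - 1) * Real.smoothTransition (4 - R⁻¹ * x 2 / 2) * cutoff ρ x ∧
      Real.smoothTransition (4 * (R⁻¹ * x 2) - 1) * Real.smoothTransition (4 - R⁻¹ * x 2 / 2) * cutoff ρ x ≤ 1 := by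
  have hg := axialProfile_nonneg_le_one (R⁻¹ * x 2)
  exact ⟨mul_nonneg hg.1 (cutoff_nonneg ρ x), mul_le_one₀ hg.2 (cutoff_nonneg ρ x) (cutoff_le_one ρ x)⟩

/-- `θ = 1` on the window `{R/2 ≤ x₂ ≤ 6R} ∩ B̄(0, ρ)` (`R, ρ > 0`). [folklore] -/
theorem axialCutoff_eq_one {R ρ : ℝ} (hR : 0 < R) (hρ : 0 < ρ) {x : E3} (h1 : R / 2 ≤ x 2) (h2 : x 2 ≤ 6 * R)
    (hx : ‖x‖ ≤ ρ) :
    Real.smoothTransition (4 * (R⁻¹ * x 2) - 1) * Real.smoothTransition (4 - R⁻¹ * x 2 / 2) * cutoff ρ x = 1 := by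
  have ht1 : 1 / 2 ≤ R⁻¹ * x 2 := by
    rw [le_inv_mul_iff₀' hR]; linarith
  have ht2 : R⁻¹ * x 2 ≤ 6 := by
    rw [inv_mul_le_iff₀ hR]; linarith
  rw [axialProfile_eq_one ht1 ht2, one_mul, cutoff_eq_one hρ hx]

/-- `θ(x) = 0` unless `R/4 < x₂ < 8R` (`R > 0`). [folklore] -/
theorem axialCutoff_eq_zero {R : ℝ} (hR : 0 < R) (ρ : ℝ) {x : E3} (hx : x 2 ≤ R / 4 ∨ 8 * R ≤ x 2) :
    Real.smoothTransition (4 * (R⁻¹ * x 2) - 1) * Real.smoothTransition (4 - R⁻¹ * x 2 / 2) * cutoff ρ x = 0 := by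
  rcases hx with hx | hx
  · have : R⁻¹ * x 2 ≤ 1 / 4 := by rw [inv_mul_le_iff₀ hR]; linarith
    rw [axialProfile_eq_zero_of_le this, zero_mul]
  · have : 8 ≤ R⁻¹ * x 2 := by rw [le_inv_mul_iff₀' hR]; linarith
    rw [axialProfile_eq_zero_of_ge this, zero_mul]

/-- The support of `θ` lies in the slab `{R/4 ≤ x₂ ≤ 8R}` (`R > 0`). [folklore] -/
theorem tsupport_axialCutoff_subset {R : ℝ} (hR : 0 < R) (ρ : ℝ) :
    tsupport (fun x : E3 => Real.smoothTransition (4 * (R⁻¹ * x 2) - 1) * Real.smoothTransition (4 - R⁻¹ * x 2 / 2) *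
      cutoff ρ x) ⊆ {x : E3 | R / 4 ≤ x 2 ∧ x 2 ≤ 8 * R} := by
  have hclosed : IsClosed {x : E3 | R / 4 ≤ x 2 ∧ x 2 ≤ 8 * R} := by
    have hc : Continuous fun x : E3 => x 2 := (EuclideanSpace.proj (2 : Fin 3) : E3 →L[ℝ] ℝ).continuous
    exact (isClosed_le continuous_const hc).inter (isClosed_le hc continuous_const)
  refine closure_minimal (fun x hx => ?_) hclosed
  rw [mem_support] at hx
  constructor
  · by_contra h; exact hx (axialCutoff_eq_zero hR ρ (Or.inl (not_le.1 h).le))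
  · by_contra h; exact hx (axialCutoff_eq_zero hR ρ (Or.inr (not_le.1 h).le))

/-- On the support slab, `‖x‖ ≥ R/4`. [folklore] -/
theorem norm_ge_of_mem_slab {R : ℝ} {x : E3} (hx : R / 4 ≤ x 2) : R / 4 ≤ ‖x‖ := by
  have h := PiLp.norm_apply_le (p := 2) x (2 : Fin 3)
  rw [Real.norm_eq_abs] at h
  exact hx.trans ((le_abs_self _).trans h)

/-! ## 3. The derivative weights `‖Dθ‖ ≤ K/R`, `‖D∇θ‖ ≤ K/R²` -/

/-- **Uniform derivative weights of the axial window cut-off.**  There is ONE constant `K` such that for all `1 ≤ R ≤ ρ` and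
all `x`: `‖Dθ(x)‖ ≤ K/R`, `‖D∇θ(x)‖ ≤ K/R²`, and both derivatives vanish unless `R/4 ≤ x₂ ≤ 8R`. [folklore] -/
theorem exists_axialCutoff_weights :
    ∃ K : ℝ, 0 < K ∧ ∀ R ρ : ℝ, 1 ≤ R → R ≤ ρ → ∀ x : E3,
      ‖fderiv ℝ (fun x : E3 => Real.smoothTransition (4 * (R⁻¹ * x 2) - 1) * Real.smoothTransition (4 - R⁻¹ * x 2 / 2) *
          cutoff ρ x) x‖ ≤ K / R ∧
      ‖fderiv ℝ (gradient (fun x : E3 => Real.smoothTransition (4 * (R⁻¹ * x 2) - 1) *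
          Real.smoothTransition (4 - R⁻¹ * x 2 / 2) * cutoff ρ x)) x‖ ≤ K / R ^ 2 ∧
      (¬ (R / 4 ≤ x 2 ∧ x 2 ≤ 8 * R) →
        fderiv ℝ (fun x : E3 => Real.smoothTransition (4 * (R⁻¹ * x 2) - 1) * Real.smoothTransition (4 - R⁻¹ * x 2 / 2) *
            cutoff ρ x) x = 0 ∧
        fderiv ℝ (gradient (fun x : E3 => Real.smoothTransition (4 * (R⁻¹ * x 2) - 1) *
            Real.smoothTransition (4 - R⁻¹ * x 2 / 2) * cutoff ρ x)) x = 0) := by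
  obtain ⟨Kg, hKg0, hKg⟩ := exists_axialProfile_iteratedFDeriv_le
  obtain ⟨c, hc1, hc⟩ := exists_norm_iteratedFDeriv_cutoff_le
  have hc0 : 0 ≤ c := zero_le_one.trans hc1
  refine ⟨16 * c + 8 * c * Kg + Kg + 1, by positivity, fun R ρ hR hRρ x => ?_⟩
  have hR0 : 0 < R := one_pos.trans_le hR
  have hρ1 : 1 ≤ ρ := hR.trans hRρ
  set g : ℝ → ℝ := fun t : ℝ => Real.smoothTransition (4 * t - 1) * Real.smoothTransition (4 - t / 2) with hgdef
  set ℓ : E3 →L[ℝ] ℝ := (R⁻¹ : ℝ) • (EuclideanSpace.proj (2 : Fin 3) : E3 →L[ℝ] ℝ) with hℓdef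
  set a : E3 → ℝ := fun x => Real.smoothTransition (4 * (R⁻¹ * x 2) - 1) * Real.smoothTransition (4 - R⁻¹ * x 2 / 2) with hadef
  set b : E3 → ℝ := cutoff ρ with hbdef
  set θ : E3 → ℝ := fun x : E3 => Real.smoothTransition (4 * (R⁻¹ * x 2) - 1) * Real.smoothTransition (4 - R⁻¹ * x 2 / 2) *
    cutoff ρ x with hθdef
  have hθab : θ = fun x => a x * b x := rfl
  have hagℓ : a = g ∘ ℓ := by
    funext y
    simp only [hadef, hgdef, hℓdef, Function.comp_apply, FunLike.coe_smul, Pi.smul_apply, smul_eq_mul]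
    rfl
  have hg : ContDiff ℝ ∞ g := axialProfile_contDiff
  have ha : ContDiff ℝ ∞ a := by rw [hagℓ]; exact hg.comp ℓ.contDiff
  have hb : ContDiff ℝ ∞ b := contDiff_cutoff ρ
  have hθs : ContDiff ℝ ∞ θ := contDiff_axialCutoff R ρ
  have hℓn : ‖ℓ‖ ≤ R⁻¹ := norm_axialCoordCLM_le hR0
  -- derivatives of `a`
  have hg2 : ContDiff ℝ 2 g := hg.of_le (by norm_cast)
  have ha2' : ContDiff ℝ 2 a := ha.of_le (by norm_cast)
  have hb2' : ContDiff ℝ 2 b := hb.of_le (by norm_cast)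
  have ha_i : ∀ i : ℕ, i ≤ 2 → ‖iteratedFDeriv ℝ i a x‖ ≤ Kg * R⁻¹ ^ i := by
    intro i hi
    rw [hagℓ, ℓ.iteratedFDeriv_comp_right hg2 x (i := i) (by exact_mod_cast hi)]
    refine (ContinuousMultilinearMap.norm_compContinuousLinearMap_le _ _).trans ?_
    rw [Finset.prod_const, Finset.card_univ, Fintype.card_fin]
    exact mul_le_mul (hKg i hi _) (pow_le_pow_left₀ (norm_nonneg _) hℓn i) (by positivity) hKg0
  have ha0 : ‖iteratedFDeriv ℝ 0 a x‖ ≤ 1 := by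
    rw [norm_iteratedFDeriv_zero, Real.norm_of_nonneg (axialProfile_nonneg_le_one _).1]
    exact (axialProfile_nonneg_le_one _).2
  have hb0 : ‖iteratedFDeriv ℝ 0 b x‖ ≤ 1 := by
    rw [norm_iteratedFDeriv_zero, Real.norm_of_nonneg (cutoff_nonneg ρ x)]
    exact cutoff_le_one ρ x
  -- the two norms in terms of `iteratedFDeriv`
  have hn1 : ‖fderiv ℝ θ x‖ = ‖iteratedFDeriv ℝ 1 θ x‖ := by
    rw [← norm_iteratedFDeriv_fderiv, norm_iteratedFDeriv_zero]
  have hn2 : ‖fderiv ℝ (gradient θ) x‖ = ‖iteratedFDeriv ℝ 2 θ x‖ := by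
    have hq : gradient θ = (InnerProductSpace.toDual ℝ E3).symm ∘ fderiv ℝ θ := rfl
    calc ‖fderiv ℝ (gradient θ) x‖ = ‖iteratedFDeriv ℝ 1 (gradient θ) x‖ := by
          rw [← norm_iteratedFDeriv_fderiv, norm_iteratedFDeriv_zero]
      _ = ‖iteratedFDeriv ℝ 2 θ x‖ := by
          rw [hq, (InnerProductSpace.toDual ℝ E3).symm.norm_iteratedFDeriv_comp_left, norm_iteratedFDeriv_fderiv]
  by_cases hx : R / 4 ≤ x 2 ∧ x 2 ≤ 8 * R
  · -- on the slab: Leibniz + envelopes with `1 + ‖x‖ ≥ R/4`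
    have hxn : R / 4 ≤ ‖x‖ := norm_ge_of_mem_slab hx.1
    have hinv1 : ((1 + ‖x‖) ^ 1)⁻¹ ≤ 4 / R := by
      rw [pow_one]; rw [inv_le_comm₀ (by positivity) (by positivity)]
      rw [inv_div]; linarith
    have hinv2 : ((1 + ‖x‖) ^ 2)⁻¹ ≤ (4 / R) ^ 2 := by
      rw [← inv_pow]
      refine pow_le_pow_left₀ (by positivity) ?_ 2
      have := hinv1; rwa [pow_one] at this
    have hb1 : ‖iteratedFDeriv ℝ 1 b x‖ ≤ c * (4 / R) := (hc ρ hρ1 1 (by norm_num) x).trans (by gcongr)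
    have hb2 : ‖iteratedFDeriv ℝ 2 b x‖ ≤ c * (4 / R) ^ 2 := (hc ρ hρ1 2 (by norm_num) x).trans (by gcongr)
    have ha1 : ‖iteratedFDeriv ℝ 1 a x‖ ≤ Kg * R⁻¹ := by simpa using ha_i 1 (by norm_num)
    have ha2 : ‖iteratedFDeriv ℝ 2 a x‖ ≤ Kg * R⁻¹ ^ 2 := ha_i 2 le_rfl
    have hL1 := norm_iteratedFDeriv_mul_le (f := a) (g := b) (n := 1) ha2' hb2' x (by norm_cast)
    have hL2 := norm_iteratedFDeriv_mul_le (f := a) (g := b) (n := 2) ha2' hb2' x (by norm_cast)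
    rw [Finset.sum_range_succ, Finset.sum_range_succ, Finset.sum_range_zero] at hL1
    rw [Finset.sum_range_succ, Finset.sum_range_succ, Finset.sum_range_succ, Finset.sum_range_zero] at hL2
    simp only [Nat.choose_zero_right, Nat.choose_self, Nat.choose_one_right, Nat.cast_one, Nat.cast_ofNat, one_mul,
      zero_add, Nat.sub_zero, Nat.reduceSub] at hL1 hL2
    have hRne : R ≠ 0 := hR0.ne'
    refine ⟨?_, ?_, fun h => (h hx).elim⟩
    · rw [hn1, hθab]
      calc ‖iteratedFDeriv ℝ 1 (fun x => a x * b x) x‖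
          ≤ ‖iteratedFDeriv ℝ 0 a x‖ * ‖iteratedFDeriv ℝ 1 b x‖ + ‖iteratedFDeriv ℝ 1 a x‖ * ‖iteratedFDeriv ℝ 0 b x‖ := hL1
        _ ≤ 1 * (c * (4 / R)) + (Kg * R⁻¹) * 1 := by
            gcongr
        _ = (4 * c + Kg) / R := by simp only [div_eq_mul_inv]; ring
        _ ≤ (16 * c + 8 * c * Kg + Kg + 1) / R :=
            div_le_div_of_nonneg_right (by nlinarith [hc0, hKg0, mul_nonneg hc0 hKg0]) hR0.le
    · rw [hn2, hθab]
      calc ‖iteratedFDeriv ℝ 2 (fun x => a x * b x) x‖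
          ≤ ‖iteratedFDeriv ℝ 0 a x‖ * ‖iteratedFDeriv ℝ 2 b x‖ + 2 * ‖iteratedFDeriv ℝ 1 a x‖ * ‖iteratedFDeriv ℝ 1 b x‖ +
            ‖iteratedFDeriv ℝ 2 a x‖ * ‖iteratedFDeriv ℝ 0 b x‖ := hL2
        _ ≤ 1 * (c * (4 / R) ^ 2) + 2 * (Kg * R⁻¹) * (c * (4 / R)) + (Kg * R⁻¹ ^ 2) * 1 := by
            gcongr
        _ = (16 * c + 8 * c * Kg + Kg) / R ^ 2 := by simp only [div_eq_mul_inv]; ring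
        _ ≤ (16 * c + 8 * c * Kg + Kg + 1) / R ^ 2 :=
            div_le_div_of_nonneg_right (by linarith) (by positivity)
  · -- off the slab every derivative vanishes
    have hxt : x ∉ tsupport θ := fun h => hx (tsupport_axialCutoff_subset hR0 ρ h)
    have h1 : iteratedFDeriv ℝ 1 θ x = 0 :=
      image_eq_zero_of_notMem_tsupport fun h => hxt (tsupport_iteratedFDeriv_subset 1 h)
    have h2 : iteratedFDeriv ℝ 2 θ x = 0 :=
      image_eq_zero_of_notMem_tsupport fun h => hxt (tsupport_iteratedFDeriv_subset 2 h)
    have hz1 : fderiv ℝ θ x = 0 := by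
      have := hn1; rw [h1, norm_zero, norm_eq_zero] at this; exact this
    have hz2 : fderiv ℝ (gradient θ) x = 0 := by
      have := hn2; rw [h2, norm_zero, norm_eq_zero] at this; exact this
    refine ⟨?_, ?_, fun _ => ⟨hz1, hz2⟩⟩
    · rw [hz1, norm_zero]; positivity
    · rw [hz2, norm_zero]; positivity

end ExtremiserLiouville

end Summit.NavierStokesRegularity.NavierStokesRegularity.Theorems

end
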